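import Mathlib
import Literature.Geometry.DiscreteGeometry.KissingPatterns
import Summits.AtomisticToContinuum.Crystallization.Theorems.DisclinationRationFiveFoldRationStubPoleLemmaAux
import Summits.AtomisticToContinuum.Crystallization.Theorems.DisclinationRationFiveFoldRationStubShellMutualAux
import Summits.AtomisticToContinuum.Crystallization.Theorems.DisclinationRationFiveFoldRationStubDichotomyAux
import Summits.AtomisticToContinuum.Crystallization.Theorems.DisclinationRationFiveFoldRationStubDichotomyDeca

/-!
# Crux `DisclinationRation.FiveFoldRation` (stmt-AtomisticToContinuum-15799), line `Sketch` —
# stub `stub_dr5_dichotomy`: Square/fold-back dichotomy and parallelogram law (pattern fact)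

For `P` = fcc, hcp or the decahedral pattern `Dc`: (i) two distinct non-adjacent pattern-neighbours
`T, T'` of a pattern point `Y` (adjacent = `dist ≤ 26/25`) either span a square/rectangular face
(`T + T' − Y ∈ P` and `dist T T' ≤ 3/2`) or fold back (`‖T + T' − Y‖ ≤ 61/100`); (ii) induced
`4`-cycles of adjacency are parallelograms (`T₁ + T₃ = T₂ + T₄`).

Proof.  fcc and hcp (`…StubDichotomyAux`): the patterns are `fccInt/√2`, `hcpInt/√18`; the real
thresholds become integer thresholds on `sqNormInt` and both clauses are `decide`d on the integer
models.  Decahedral pattern (this file, on top of `…StubDichotomyDeca`): the points are the poles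
`(0,0,±1)` and the ring points `r(k, σ) = (√3/2·cos(2πk/5), √3/2·sin(2πk/5), σ)`, `σ = ±1/2`; the
neighbours of a pole are its five ring points, those of `r(k, σ)` are its pole, its partner
`r(k, -σ)` and its ring-mates `r(k ± 1, σ)` (`dr5pl_near_ring`); clause (i) is the abstract case
analysis `dr5di_dicho_abstract` fed with the distances of `…StubPoleLemmaAux` (squares: the
rectangles `r(k,σ) r(k±1,σ) r(k±1,-σ) r(k,-σ)`, diagonal² `= (23 - 3√5)/8 ≤ 9/4`; fold-backs:
`‖·‖² ∈ {0, 3(3-√5)/8, (23-9√5)/8} ≤ (61/100)²`), and clause (ii) follows from (i) by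
polarization (`dr5di_cycle_of_dicho`: `Deca` is `1`-separated with spectral gap `dist² ≥ 2` beyond
adjacency, `dr5di_deca_gap`).

Registered signature: `Cruxes/FiveFoldRation/Lines/Sketch.lean` (v4), `let`-abbreviated style
where applicable.
-/

noncomputable section

namespace Summit.AtomisticToContinuum.Crystallization.Theorems

/-! ### The decahedral pattern: neighbours, distances, apex identities, spectral gap -/

/-- Every point of `Deca` is a pole `(0, 0, 2σ)` or a ring point `r(k, σ)` with `σ = ±1/2`. -/
theorem dr5di_deca_mem (x : EuclideanSpace ℝ (Fin 3))
    (hx : x ∈ {p : EuclideanSpace ℝ (Fin 3) | p = !₂[(0 : ℝ), 0, 1] ∨ p = !₂[(0 : ℝ), 0, -1] ∨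
      ∃ k : Fin 5, ∃ σ : ℝ, (σ = 1 / 2 ∨ σ = -(1 / 2)) ∧
        p = !₂[Real.sqrt 3 / 2 * Real.cos (2 * Real.pi * (k : ℝ) / 5),
          Real.sqrt 3 / 2 * Real.sin (2 * Real.pi * (k : ℝ) / 5), σ]}) :
    ∃ σ : ℝ, (σ = 1 / 2 ∨ σ = -(1 / 2)) ∧ (x = !₂[(0 : ℝ), 0, 2 * σ] ∨ ∃ k : Fin 5,
      x = !₂[Real.sqrt 3 / 2 * Real.cos (2 * Real.pi * ((k : Fin 5) : ℝ) / 5),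
          Real.sqrt 3 / 2 * Real.sin (2 * Real.pi * ((k : Fin 5) : ℝ) / 5), σ]) := by
  rcases hx with rfl | rfl | ⟨k, σ, hσ, rfl⟩
  · exact ⟨1 / 2, Or.inl rfl, Or.inl (by norm_num)⟩
  · exact ⟨-(1 / 2), Or.inr rfl, Or.inl (by norm_num)⟩
  · exact ⟨σ, hσ, Or.inr ⟨k, rfl⟩⟩

/-- The points of `Deca` adjacent (`dist ≤ 26/25`) to a pole are the pole and its ring. -/
theorem dr5di_deca_adjP (σ : ℝ) (hσ : σ = 1 / 2 ∨ σ = -(1 / 2)) (x : EuclideanSpace ℝ (Fin 3))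
    (hx : x ∈ {p : EuclideanSpace ℝ (Fin 3) | p = !₂[(0 : ℝ), 0, 1] ∨ p = !₂[(0 : ℝ), 0, -1] ∨
      ∃ k : Fin 5, ∃ σ : ℝ, (σ = 1 / 2 ∨ σ = -(1 / 2)) ∧
        p = !₂[Real.sqrt 3 / 2 * Real.cos (2 * Real.pi * (k : ℝ) / 5),
          Real.sqrt 3 / 2 * Real.sin (2 * Real.pi * (k : ℝ) / 5), σ]})
    (hd : dist (!₂[(0 : ℝ), 0, 2 * σ] : EuclideanSpace ℝ (Fin 3)) x ≤ 26 / 25) :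
    x = !₂[(0 : ℝ), 0, 2 * σ] ∨ ∃ k : Fin 5,
      x = !₂[Real.sqrt 3 / 2 * Real.cos (2 * Real.pi * ((k : Fin 5) : ℝ) / 5),
          Real.sqrt 3 / 2 * Real.sin (2 * Real.pi * ((k : Fin 5) : ℝ) / 5), σ] := by
  rcases hx with rfl | rfl | ⟨k, τ, hτ, rfl⟩
  · rw [dr5di_axis_dist] at hd
    rcases hσ with rfl | rfl
    · left; norm_num
    · norm_num at hd
  · rw [dr5di_axis_dist] at hd
    rcases hσ with rfl | rfl
    · norm_num at hd
    · left; norm_num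
  · have h2 := dr5di_sq_le hd
    rw [dist_comm, dr5pl_ring_axis_dist_sq] at h2
    have hτσ : τ = σ := by
      rcases hσ with rfl | rfl <;> rcases hτ with rfl | rfl <;> first | rfl | norm_num at h2
    subst hτσ
    exact Or.inr ⟨k, rfl⟩

/-- The points of `Deca` adjacent to a ring point `r(k, σ)` are itself, its pole, its partner
`r(k, -σ)` and its ring-mates `r(k ± 1, σ)`. -/
theorem dr5di_deca_adjR (k : Fin 5) (σ : ℝ) (hσ : σ = 1 / 2 ∨ σ = -(1 / 2))
    (x : EuclideanSpace ℝ (Fin 3))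
    (hx : x ∈ {p : EuclideanSpace ℝ (Fin 3) | p = !₂[(0 : ℝ), 0, 1] ∨ p = !₂[(0 : ℝ), 0, -1] ∨
      ∃ k : Fin 5, ∃ σ : ℝ, (σ = 1 / 2 ∨ σ = -(1 / 2)) ∧
        p = !₂[Real.sqrt 3 / 2 * Real.cos (2 * Real.pi * (k : ℝ) / 5),
          Real.sqrt 3 / 2 * Real.sin (2 * Real.pi * (k : ℝ) / 5), σ]})
    (hd : dist (!₂[Real.sqrt 3 / 2 * Real.cos (2 * Real.pi * ((k : Fin 5) : ℝ) / 5),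
          Real.sqrt 3 / 2 * Real.sin (2 * Real.pi * ((k : Fin 5) : ℝ) / 5), σ] :
        EuclideanSpace ℝ (Fin 3)) x ≤ 26 / 25) :
    x = !₂[Real.sqrt 3 / 2 * Real.cos (2 * Real.pi * ((k : Fin 5) : ℝ) / 5),
          Real.sqrt 3 / 2 * Real.sin (2 * Real.pi * ((k : Fin 5) : ℝ) / 5), σ] ∨
    x = !₂[(0 : ℝ), 0, 2 * σ] ∨
    x = !₂[Real.sqrt 3 / 2 * Real.cos (2 * Real.pi * ((k : Fin 5) : ℝ) / 5),
          Real.sqrt 3 / 2 * Real.sin (2 * Real.pi * ((k : Fin 5) : ℝ) / 5), -σ] ∨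
    x = !₂[Real.sqrt 3 / 2 * Real.cos (2 * Real.pi * ((k + 1 : Fin 5) : ℝ) / 5),
          Real.sqrt 3 / 2 * Real.sin (2 * Real.pi * ((k + 1 : Fin 5) : ℝ) / 5), σ] ∨
    x = !₂[Real.sqrt 3 / 2 * Real.cos (2 * Real.pi * ((k - 1 : Fin 5) : ℝ) / 5),
          Real.sqrt 3 / 2 * Real.sin (2 * Real.pi * ((k - 1 : Fin 5) : ℝ) / 5), σ] := by
  by_cases hne : x = !₂[Real.sqrt 3 / 2 * Real.cos (2 * Real.pi * ((k : Fin 5) : ℝ) / 5),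
          Real.sqrt 3 / 2 * Real.sin (2 * Real.pi * ((k : Fin 5) : ℝ) / 5), σ]
  · exact Or.inl hne
  · right
    have h := dr5pl_near_ring k σ hσ x hx hne (by rw [dist_comm]; linarith)
    simpa only [Finset.mem_insert, Finset.mem_singleton] using h

/-- Pole–ring distances in `Deca`: `1` on the same side, `√3` across. -/
theorem dr5di_deca_PR (k : Fin 5) (σ : ℝ) (hσ : σ = 1 / 2 ∨ σ = -(1 / 2)) :
    dist (!₂[(0 : ℝ), 0, 2 * σ] : EuclideanSpace ℝ (Fin 3))
        !₂[Real.sqrt 3 / 2 * Real.cos (2 * Real.pi * ((k : Fin 5) : ℝ) / 5),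
          Real.sqrt 3 / 2 * Real.sin (2 * Real.pi * ((k : Fin 5) : ℝ) / 5), σ] = 1 ∧
      dist (!₂[(0 : ℝ), 0, 2 * σ] : EuclideanSpace ℝ (Fin 3))
        !₂[Real.sqrt 3 / 2 * Real.cos (2 * Real.pi * ((k : Fin 5) : ℝ) / 5),
          Real.sqrt 3 / 2 * Real.sin (2 * Real.pi * ((k : Fin 5) : ℝ) / 5), -σ] ^ 2 = 3 := by
  constructor
  · have h := dr5pl_ring_axis_dist_sq k σ (2 * σ)
    have h1 : dist (!₂[Real.sqrt 3 / 2 * Real.cos (2 * Real.pi * ((k : Fin 5) : ℝ) / 5),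
          Real.sqrt 3 / 2 * Real.sin (2 * Real.pi * ((k : Fin 5) : ℝ) / 5), σ] :
          EuclideanSpace ℝ (Fin 3)) (!₂[(0 : ℝ), 0, 2 * σ]) ^ 2 = 1 := by
      rw [h]; rcases hσ with rfl | rfl <;> norm_num
    rw [dist_comm]
    have h0 := dist_nonneg
      (x := (!₂[Real.sqrt 3 / 2 * Real.cos (2 * Real.pi * ((k : Fin 5) : ℝ) / 5),
          Real.sqrt 3 / 2 * Real.sin (2 * Real.pi * ((k : Fin 5) : ℝ) / 5), σ] :
        EuclideanSpace ℝ (Fin 3)))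
      (y := (!₂[(0 : ℝ), 0, 2 * σ] : EuclideanSpace ℝ (Fin 3)))
    nlinarith
  · rw [dist_comm, dr5pl_ring_axis_dist_sq]
    rcases hσ with rfl | rfl <;> norm_num

/-- The rectangle apex identities `r(k, -σ) + r(k ± 1, σ) - r(k, σ) = r(k ± 1, -σ)`. -/
theorem dr5di_deca_apex (k : Fin 5) (σ : ℝ) :
    (!₂[Real.sqrt 3 / 2 * Real.cos (2 * Real.pi * ((k : Fin 5) : ℝ) / 5),
          Real.sqrt 3 / 2 * Real.sin (2 * Real.pi * ((k : Fin 5) : ℝ) / 5), -σ] :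
        EuclideanSpace ℝ (Fin 3)) +
        !₂[Real.sqrt 3 / 2 * Real.cos (2 * Real.pi * ((k + 1 : Fin 5) : ℝ) / 5),
          Real.sqrt 3 / 2 * Real.sin (2 * Real.pi * ((k + 1 : Fin 5) : ℝ) / 5), σ] -
        !₂[Real.sqrt 3 / 2 * Real.cos (2 * Real.pi * ((k : Fin 5) : ℝ) / 5),
          Real.sqrt 3 / 2 * Real.sin (2 * Real.pi * ((k : Fin 5) : ℝ) / 5), σ] =
      !₂[Real.sqrt 3 / 2 * Real.cos (2 * Real.pi * ((k + 1 : Fin 5) : ℝ) / 5),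
          Real.sqrt 3 / 2 * Real.sin (2 * Real.pi * ((k + 1 : Fin 5) : ℝ) / 5), -σ] ∧
    (!₂[Real.sqrt 3 / 2 * Real.cos (2 * Real.pi * ((k : Fin 5) : ℝ) / 5),
          Real.sqrt 3 / 2 * Real.sin (2 * Real.pi * ((k : Fin 5) : ℝ) / 5), -σ] :
        EuclideanSpace ℝ (Fin 3)) +
        !₂[Real.sqrt 3 / 2 * Real.cos (2 * Real.pi * ((k - 1 : Fin 5) : ℝ) / 5),
          Real.sqrt 3 / 2 * Real.sin (2 * Real.pi * ((k - 1 : Fin 5) : ℝ) / 5), σ] -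
        !₂[Real.sqrt 3 / 2 * Real.cos (2 * Real.pi * ((k : Fin 5) : ℝ) / 5),
          Real.sqrt 3 / 2 * Real.sin (2 * Real.pi * ((k : Fin 5) : ℝ) / 5), σ] =
      !₂[Real.sqrt 3 / 2 * Real.cos (2 * Real.pi * ((k - 1 : Fin 5) : ℝ) / 5),
          Real.sqrt 3 / 2 * Real.sin (2 * Real.pi * ((k - 1 : Fin 5) : ℝ) / 5), -σ] := by
  constructor <;> (ext i; fin_cases i <;> simp)

/-- **Spectral gap of `Deca`**: two non-adjacent points are at squared distance `≥ 2` (the value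
after `1.0365` is `2.0365`, the rectangle diagonal). -/
theorem dr5di_deca_gap :
    ∀ x ∈ {p : EuclideanSpace ℝ (Fin 3) | p = !₂[(0 : ℝ), 0, 1] ∨ p = !₂[(0 : ℝ), 0, -1] ∨
      ∃ k : Fin 5, ∃ σ : ℝ, (σ = 1 / 2 ∨ σ = -(1 / 2)) ∧
        p = !₂[Real.sqrt 3 / 2 * Real.cos (2 * Real.pi * (k : ℝ) / 5),
          Real.sqrt 3 / 2 * Real.sin (2 * Real.pi * (k : ℝ) / 5), σ]},
    ∀ y ∈ {p : EuclideanSpace ℝ (Fin 3) | p = !₂[(0 : ℝ), 0, 1] ∨ p = !₂[(0 : ℝ), 0, -1] ∨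
      ∃ k : Fin 5, ∃ σ : ℝ, (σ = 1 / 2 ∨ σ = -(1 / 2)) ∧
        p = !₂[Real.sqrt 3 / 2 * Real.cos (2 * Real.pi * (k : ℝ) / 5),
          Real.sqrt 3 / 2 * Real.sin (2 * Real.pi * (k : ℝ) / 5), σ]},
    26 / 25 < dist x y → 2 ≤ dist x y ^ 2 := by
  have h5lo : (2236 : ℝ) / 1000 < Real.sqrt 5 := by rw [Real.lt_sqrt (by norm_num)]; norm_num
  have h5hi : Real.sqrt 5 < 2237 / 1000 := by rw [Real.sqrt_lt' (by norm_num)]; norm_num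
  obtain ⟨hc14, hc23⟩ := dr5di_cos_vals
  intro x hx y hy hxy
  have h2 := dr5di_lt_sq hxy
  rcases hx with rfl | rfl | ⟨k, σ, hσ, rfl⟩ <;> rcases hy with rfl | rfl | ⟨k', σ', hσ', rfl⟩
  · rw [dist_self] at hxy; norm_num at hxy
  · rw [dr5di_axis_dist]; norm_num
  · rw [dist_comm, dr5pl_ring_axis_dist_sq] at h2 ⊢
    rcases hσ' with rfl | rfl
    · norm_num at h2
    · norm_num
  · rw [dr5di_axis_dist]; norm_num
  · rw [dist_self] at hxy; norm_num at hxy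
  · rw [dist_comm, dr5pl_ring_axis_dist_sq] at h2 ⊢
    rcases hσ' with rfl | rfl
    · norm_num
    · norm_num at h2
  · rw [dr5pl_ring_axis_dist_sq] at h2 ⊢
    rcases hσ with rfl | rfl
    · norm_num at h2
    · norm_num
  · rw [dr5pl_ring_axis_dist_sq] at h2 ⊢
    rcases hσ with rfl | rfl
    · norm_num
    · norm_num at h2
  · rw [dr5pl_ring_dist_sq] at h2 ⊢
    have hs : (σ - σ') ^ 2 = 0 ∨ (σ - σ') ^ 2 = 1 := by
      rcases hσ with rfl | rfl <;> rcases hσ' with rfl | rfl <;> norm_num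
    rcases dr5di_fin5_cases (k - k') with e | e | e | e | e <;> rw [e] at h2 ⊢
    · simp only [Fin.val_zero, Nat.cast_zero, mul_zero, zero_div, Real.cos_zero] at h2
      rcases hs with hs | hs <;> rw [hs] at h2 <;> norm_num at h2
    · rw [hc14 1 (Or.inl rfl)] at h2 ⊢
      rcases hs with hs | hs <;> rw [hs] at h2 ⊢ <;> linarith
    · rw [hc23 2 (Or.inl rfl)]; rcases hs with hs | hs <;> rw [hs] <;> linarith
    · rw [hc23 3 (Or.inr rfl)]; rcases hs with hs | hs <;> rw [hs] <;> linarith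
    · rw [hc14 4 (Or.inr rfl)] at h2 ⊢
      rcases hs with hs | hs <;> rw [hs] at h2 ⊢ <;> linarith

/-- **Square/fold-back dichotomy and parallelogram law for the decahedral pattern.** -/
theorem dr5di_deca (P : Set (EuclideanSpace ℝ (Fin 3)))
    (hP : P = {p : EuclideanSpace ℝ (Fin 3) | p = !₂[(0 : ℝ), 0, 1] ∨ p = !₂[(0 : ℝ), 0, -1] ∨
      ∃ k : Fin 5, ∃ σ : ℝ, (σ = 1 / 2 ∨ σ = -(1 / 2)) ∧
        p = !₂[Real.sqrt 3 / 2 * Real.cos (2 * Real.pi * (k : ℝ) / 5),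
          Real.sqrt 3 / 2 * Real.sin (2 * Real.pi * (k : ℝ) / 5), σ]}) :
    (∀ Y ∈ P, ∀ T ∈ P, ∀ T' ∈ P, dist Y T ≤ 26 / 25 → dist Y T' ≤ 26 / 25 → T ≠ T' →
      26 / 25 < dist T T' → ((T + T' - Y ∈ P ∧ dist T T' ≤ 3 / 2) ∨ ‖T + T' - Y‖ ≤ 61 / 100)) ∧
    (∀ T₁ ∈ P, ∀ T₂ ∈ P, ∀ T₃ ∈ P, ∀ T₄ ∈ P, dist T₁ T₂ ≤ 26 / 25 → dist T₂ T₃ ≤ 26 / 25 →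
      dist T₃ T₄ ≤ 26 / 25 → dist T₄ T₁ ≤ 26 / 25 → 26 / 25 < dist T₁ T₃ → 26 / 25 < dist T₂ T₄ →
        T₁ + T₃ = T₂ + T₄) := by
  subst hP
  have hi := dr5di_dicho_abstract
    (P := {p : EuclideanSpace ℝ (Fin 3) | p = !₂[(0 : ℝ), 0, 1] ∨ p = !₂[(0 : ℝ), 0, -1] ∨
      ∃ k : Fin 5, ∃ σ : ℝ, (σ = 1 / 2 ∨ σ = -(1 / 2)) ∧
        p = !₂[Real.sqrt 3 / 2 * Real.cos (2 * Real.pi * (k : ℝ) / 5),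
          Real.sqrt 3 / 2 * Real.sin (2 * Real.pi * (k : ℝ) / 5), σ]})
    (pole := fun σ => !₂[(0 : ℝ), 0, 2 * σ])
    (ring := fun k σ => !₂[Real.sqrt 3 / 2 * Real.cos (2 * Real.pi * ((k : Fin 5) : ℝ) / 5),
          Real.sqrt 3 / 2 * Real.sin (2 * Real.pi * ((k : Fin 5) : ℝ) / 5), σ])
    (c := fun m => Real.cos (2 * Real.pi * (m : ℝ) / 5))
    dr5di_deca_mem (fun k σ hσ => Or.inr (Or.inr ⟨k, σ, hσ, rfl⟩)) dr5sm_deca_norm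
    dr5di_deca_adjP dr5di_deca_adjR (fun k σ hσ => (dr5di_deca_PR k σ hσ).1)
    (fun k σ hσ => (dr5di_deca_PR k σ hσ).2) dr5pl_ring_dist_sq (by simp) dr5di_cos_vals.1
    dr5di_cos_vals.2 dr5di_deca_apex
  exact ⟨hi, dr5di_cycle_of_dicho dr5sm_deca_norm
    (fun x hx y hy hne => dr5sm_deca_sep x y hx hy hne) dr5di_deca_gap hi⟩

/-! ### The registered stub -/

/-- For `P` = fcc, hcp or the decahedral pattern `Dc`: (i) two distinct non-adjacent pattern-neighbours `T, T'` of a pattern point `Y` (adjacent = `dist ≤ 26/25`) either span a square/rectangular face (`T + T' − Y ∈ P` and `dist T T' ≤ 3/2`) or fold back (`‖T + T' − Y‖ ≤ 61/100`); (ii) induced 4-cycles of adjacency are parallelograms (`T₁ + T₃ = T₂ + T₄`). -/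
theorem stub_dr5_dichotomy : (let Dc := {p : EuclideanSpace ℝ (Fin 3) | p = !₂[(0 : ℝ), 0, 1] ∨ p = !₂[(0 : ℝ), 0, -1] ∨ ∃ k : Fin 5, ∃ σ : ℝ, (σ = 1 / 2 ∨ σ = -(1 / 2)) ∧ p = !₂[Real.sqrt 3 / 2 * Real.cos (2 * Real.pi * (k : ℝ) / 5), Real.sqrt 3 / 2 * Real.sin (2 * Real.pi * (k : ℝ) / 5), σ]}; ∀ P : Set (EuclideanSpace ℝ (Fin 3)), (P = (↑Literature.Geometry.DiscreteGeometry.fccKissingPattern : Set (EuclideanSpace ℝ (Fin 3))) ∨ P = (↑Literature.Geometry.DiscreteGeometry.hcpKissingPattern : Set (EuclideanSpace ℝ (Fin 3))) ∨ P = Dc) → (∀ Y ∈ P, ∀ T ∈ P, ∀ T' ∈ P, dist Y T ≤ 26 / 25 → dist Y T' ≤ 26 / 25 → T ≠ T' → 26 / 25 < dist T T' → ((T + T' - Y ∈ P ∧ dist T T' ≤ 3 / 2) ∨ ‖T + T' - Y‖ ≤ 61 / 100)) ∧ (∀ T₁ ∈ P, ∀ T₂ ∈ P, ∀ T₃ ∈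 P, ∀ T₄ ∈ P, dist T₁ T₂ ≤ 26 / 25 → dist T₂ T₃ ≤ 26 / 25 → dist T₃ T₄ ≤ 26 / 25 → dist T₄ T₁ ≤ 26 / 25 → 26 / 25 < dist T₁ T₃ → 26 / 25 < dist T₂ T₄ → T₁ + T₃ = T₂ + T₄)) := by
  dsimp only
  intro P hP
  rcases hP with rfl | rfl | hP
  · exact dr5di_fcc
  · exact dr5di_hcp
  · exact dr5di_deca P hP

end Summit.AtomisticToContinuum.Crystallization.Theorems

end
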